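import Summits.ABC.ABC.Theses.IsogenyGlueCongruence
import Summits.ABC.ABC.Theorems.SharpDegreeOfPolyDegree.Negative.ExponentFloor
import Summits.ABC.ABC.Theorems.FreyDegreeBound.Negative.ExponentBelowTwo

/-!
# `PolyHeightOfBoundedPrimes` (stmt-ABC-16006, crux B') — the archimedean component `|c₄|³` of the
consequent alone already forces the exponent up to Szpiro's `6`

Negative support (cdisprove seat `refuter-cdisprove-stmt-ABC-16006-0`, cycle 1, 2026-08-16).
The consequent `H` of B' bounds `max(|Δ_W|, |c₄(W)|³) ≤ C·N_W^σ`; the landed floor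
(`SharpDegreeOfPolyHeight.Negative.not_polyHeightAt_of_le_six`, Masser 1990) kills every slice
`σ ≤ 6` through the DISCRIMINANT component. Crux-ideate card `archimedean-hall-split` proposes to
split `H` into a finite part (`|Δ_min| ≤ C N^σ`) and an archimedean / Hall part controlling `|c₄|³`.
Recorded here, kernel-checked: the archimedean component ON ITS OWN has (essentially) the same floor —
on Masser's semistable Frey curves `Δ > 0`, so `c₄³ = c₆² + 1728Δ ≥ 1728Δ = 1728|Δ_min| ≥ 1728N⁶`
on the global minimal model:

* `exists_globallyMinimal_model_pos` — transport to a global minimal model keeping the SIGN of `Δ`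
  (the landed `exists_globallyMinimal_model` only returns `|Δ|`);
* `exists_curve_c4_gt_of_lt_six`, `not_polyC4At_of_lt_six` — for every `σ < 6` and every `C` a
  semistable elliptic `W/ℚ` in global minimal form with `C·N^σ < |c₄(W)|³`; so no statement
  `∃ C, ∀ W, |c₄|³ ≤ C·N^σ` with `σ < 6` can be filed as the archimedean half, and any witness
  exponent of such a half is `≥ 6` (`six_le_of_polyC4At`).

(`σ = 6` with an arbitrary constant would need the polylog excess of
`Masser.exists_semistable_curve_polylog_excess` with the sign of `Δ` exported — not done here.)
No Theses statement is asserted.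
-/

noncomputable section

-- `Summit.<Summit>.<Problem>`: for the single-conjunct summit `ABC` the duplicate `ABC.ABC` is mandated.
set_option linter.dupNamespace false

open Summit.ABC.ABC.Theses.IsogenyGlueCongruence
open WeierstrassCurve IsDedekindDomain
open Literature.NumberTheory.EllipticCurves

namespace Summit.ABC.ABC.Theorems.PolyHeightOfBoundedPrimes.Negative

/-- **Global minimal model, sign-carrying form.** Every elliptic `W/ℚ` with `Δ_W > 0` has a globally
minimal model `W₁` with the same conductor, `|Δ_{W₁}| = |Δ_min(W)|`, semistable if `W` is, and
`Δ_{W₁} > 0` (`Δ` scales by `u⁻¹²`). Copy of `SharpDegreeOfPolyDegree.Negative.exists_globallyMinimal_model`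
with the sign tracked. [cite: SilvermanAEC2009, VIII.8 Cor. 8.3] -/
theorem exists_globallyMinimal_model_pos (W : WeierstrassCurve ℚ) [W.IsElliptic] (hpos : 0 < W.Δ) :
    ∃ W₁ : WeierstrassCurve ℚ, W₁.IsElliptic ∧ W₁.IsGloballyMinimal ∧
      (W.IsSemistable ℤ → W₁.IsSemistable ℤ) ∧ W₁.conductorNorm ℤ = W.conductorNorm ℤ ∧
      ((|W₁.Δ| : ℚ) : ℝ) = (W.minimalDiscriminantNorm ℤ : ℝ) ∧ 0 < W₁.Δ := by
  obtain ⟨Cv, W₀, hCW, hmin⟩ := W.exists_baseChange_int_forall_isMinimalAt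
  have hΔ0 : W₀.Δ ≠ 0 := by
    intro h0
    have h1 : (Cv • W).Δ = 0 := by
      simp [hCW, WeierstrassCurve.baseChange, WeierstrassCurve.map_Δ, h0]
    exact (Cv • W).isUnit_Δ.ne_zero h1
  haveI hE₁ : (W₀.baseChange ℚ).IsElliptic := isElliptic_baseChange_int W₀ hΔ0
  haveI hM₁ : (W₀.baseChange ℚ).IsGloballyMinimal :=
    isGloballyMinimal_of_forall_isMinimalAt_int _ hmin
  refine ⟨W₀.baseChange ℚ, hE₁, hM₁, fun hss => ?_, ?_, ?_, ?_⟩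
  · rw [← hCW]
    exact (isSemistable_smul_iff_holds ℤ W Cv).mpr hss
  · rw [← hCW, conductorNorm_smul_rat]
  · have hD₁ : W.minimalDiscriminantNorm ℤ = W₀.Δ.natAbs := by
      rw [← minimalDiscriminantNorm_smul_rat W Cv, hCW,
        minimalDiscriminantNorm_eq_natAbs_holds W₀ hΔ0 hmin]
    have hΔ : (W₀.baseChange ℚ).Δ = (W₀.Δ : ℚ) := by
      simp [WeierstrassCurve.baseChange, WeierstrassCurve.map_Δ]
    rw [hD₁, hΔ, Nat.cast_natAbs]
    push_cast
    rfl
  · rw [← hCW, variableChange_Δ]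
    exact mul_pos (Even.pow_pos ⟨6, rfl⟩ (Units.ne_zero _)) hpos

/-- **Witness form.** For `σ < 6` and every real `C` there is a semistable elliptic curve over `ℚ` in
global minimal form with `C·N^σ < |c₄|³` — Masser-type Frey pairs (`exists_frey_pair_excess`:
`N⁶ ≤ |Δ_min|`, `N → ∞`) have `Δ > 0`, whence `|c₄|³ ≥ c₄³ = c₆² + 1728Δ ≥ 1728|Δ_min| ≥ N⁶ > C·N^σ`
for `N` large. [cite: Masser1990, Lemma 1] -/
theorem exists_curve_c4_gt_of_lt_six {σ : ℝ} (hσ : σ < 6) (C : ℝ) :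
    ∃ W : WeierstrassCurve ℚ, W.IsElliptic ∧ W.IsGloballyMinimal ∧ W.IsSemistable ℤ ∧
      0 < W.conductorNorm ℤ ∧
      C * (W.conductorNorm ℤ : ℝ) ^ σ < ((|W.c₄| ^ 3 : ℚ) : ℝ) := by
  set M : ℝ := max C 1 with hM
  have hM1 : 1 ≤ M := le_max_right _ _
  have hM0 : 0 < M := by linarith
  set e : ℝ := 6 - σ with he
  have he0 : 0 < e := by rw [he]; linarith
  have heσ : e + σ = 6 := by rw [he]; ring
  set T : ℝ := M ^ e⁻¹ with hT
  have hT0 : 0 ≤ T := Real.rpow_nonneg hM0.le _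
  obtain ⟨A, B, hAB, h0, hA, hB, hN, hexcess, -⟩ :=
    Summit.ABC.ABC.Theorems.FreyDegreeBound.Negative.exists_frey_pair_excess ⌈T⌉₊
  haveI hW : (freyCurve A B).IsElliptic := isElliptic_freyCurve h0
  have hss : (freyCurve A B).IsSemistable ℤ := isSemistable_freyCurve_of_mod_holds A B hAB h0 hA hB
  have h0q : ((A : ℚ) * B * (A + B)) ≠ 0 := by exact_mod_cast h0
  have hΔW : 0 < (freyCurve A B).Δ := by
    rw [freyCurve_Δ]
    exact mul_pos (by norm_num) (by positivity)
  have hD : 2 ^ 8 * (freyCurve A B).minimalDiscriminantNorm ℤ = ((A * B * (A + B)) ^ 2).natAbs :=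
    minimalDiscriminantNorm_freyCurve_of_mod_holds A B hAB h0 hA hB
  obtain ⟨W₁, hE₁, hM₁, hss₁, hN₁, hΔ₁, hpos₁⟩ := exists_globallyMinimal_model_pos (freyCurve A B) hΔW
  refine ⟨W₁, hE₁, hM₁, hss₁ hss, ?_, ?_⟩
  · rw [hN₁]; exact (freyCurve A B).conductorNorm_pos_holds
  rw [hN₁]
  set N : ℕ := (freyCurve A B).conductorNorm ℤ with hNdef
  -- `T < N`, so `M < N^e`
  have hNT : T < (N : ℝ) := (Nat.le_ceil T).trans_lt (by exact_mod_cast hN)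
  have hN0 : (0 : ℝ) < N := hT0.trans_lt hNT
  have hNe : M < (N : ℝ) ^ e := by
    have h := Real.rpow_lt_rpow hT0 hNT he0
    rwa [hT, Real.rpow_inv_rpow hM0.le he0.ne'] at h
  have hNσ0 : 0 < (N : ℝ) ^ σ := Real.rpow_pos_of_pos hN0 σ
  have hsplit : (N : ℝ) ^ (6 : ℝ) = (N : ℝ) ^ e * (N : ℝ) ^ σ := by
    rw [← heσ, Real.rpow_add hN0]
  -- `C N^σ < N^6`
  have h1 : C * (N : ℝ) ^ σ < (N : ℝ) ^ (6 : ℝ) := by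
    calc C * (N : ℝ) ^ σ ≤ M * (N : ℝ) ^ σ := mul_le_mul_of_nonneg_right (le_max_left _ _) hNσ0.le
      _ < (N : ℝ) ^ e * (N : ℝ) ^ σ := mul_lt_mul_of_pos_right hNe hNσ0
      _ = (N : ℝ) ^ (6 : ℝ) := hsplit.symm
  -- `N^6 ≤ |Δ_min|`
  have hexcess' : N ^ 6 ≤ (freyCurve A B).minimalDiscriminantNorm ℤ := by
    have h2 : 2 ^ 8 * N ^ 6 ≤ 2 ^ 8 * (freyCurve A B).minimalDiscriminantNorm ℤ := by
      rw [hD, Int.natAbs_pow]; exact hexcess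
    exact Nat.le_of_mul_le_mul_left h2 (by norm_num)
  have h2 : (N : ℝ) ^ (6 : ℝ) ≤ ((freyCurve A B).minimalDiscriminantNorm ℤ : ℝ) := by
    have h6 : (N : ℝ) ^ (6 : ℝ) = (N : ℝ) ^ (6 : ℕ) := by norm_cast
    rw [h6]
    exact_mod_cast hexcess'
  -- `|Δ_min| = |Δ(W₁)| ≤ 1728 |Δ(W₁)| ≤ |c₄(W₁)|³`
  have hc4 : |W₁.Δ| ≤ |W₁.c₄| ^ 3 := by
    have hrel : (1728 : ℚ) * W₁.Δ = W₁.c₄ ^ 3 - W₁.c₆ ^ 2 := W₁.c_relation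
    rw [abs_of_pos hpos₁]
    calc W₁.Δ ≤ 1728 * W₁.Δ := le_mul_of_one_le_left hpos₁.le (by norm_num)
      _ = W₁.c₄ ^ 3 - W₁.c₆ ^ 2 := hrel
      _ ≤ W₁.c₄ ^ 3 := sub_le_self _ (sq_nonneg _)
      _ ≤ |W₁.c₄ ^ 3| := le_abs_self _
      _ = |W₁.c₄| ^ 3 := abs_pow _ _
  have h3 : ((freyCurve A B).minimalDiscriminantNorm ℤ : ℝ) ≤ ((|W₁.c₄| ^ 3 : ℚ) : ℝ) := by
    rw [← hΔ₁]
    exact_mod_cast hc4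
  exact h1.trans_le (h2.trans h3)

/-- **The archimedean component has floor `6`.** For no `σ < 6` is there a constant `C` with
`|c₄(W)|³ ≤ C·N_W^σ` for every semistable elliptic `W/ℚ` in global minimal form: the `c₄`-part of
the consequent of B' cannot be had below Szpiro's exponent either (cf. card archimedean-hall-split).
[cite: Masser1990, Lemma 1] -/
theorem not_polyC4At_of_lt_six {σ : ℝ} (hσ : σ < 6) :
    ¬ ∃ C : ℝ, ∀ (W : WeierstrassCurve ℚ) [W.IsElliptic] [W.IsGloballyMinimal]
      [NeZero (W.conductorNorm ℤ)], W.IsSemistable ℤ →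
        ((|W.c₄| ^ 3 : ℚ) : ℝ) ≤ C * (W.conductorNorm ℤ : ℝ) ^ σ := by
  rintro ⟨C, hC⟩
  obtain ⟨W, hE, hM, hss, hN, hlt⟩ := exists_curve_c4_gt_of_lt_six hσ C
  haveI := hE
  haveI := hM
  haveI : NeZero (W.conductorNorm ℤ) := ⟨hN.ne'⟩
  exact absurd (hC W hss) (not_le.mpr hlt)

/-- **Any exponent of an archimedean half is at least `6`.** If `|c₄(W)|³ ≤ C·N_W^σ` holds on all
semistable global minimal elliptic `W/ℚ`, then `6 ≤ σ`. [cite: Masser1990, Lemma 1] -/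
theorem six_le_of_polyC4At {σ C : ℝ}
    (h : ∀ (W : WeierstrassCurve ℚ) [W.IsElliptic] [W.IsGloballyMinimal]
      [NeZero (W.conductorNorm ℤ)], W.IsSemistable ℤ →
        ((|W.c₄| ^ 3 : ℚ) : ℝ) ≤ C * (W.conductorNorm ℤ : ℝ) ^ σ) : 6 ≤ σ :=
  not_lt.mp fun hσ => not_polyC4At_of_lt_six hσ ⟨C, fun W _ _ _ hW => h W hW⟩

end Summit.ABC.ABC.Theorems.PolyHeightOfBoundedPrimes.Negative

end
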